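import Literature.Analysis.FluidPDE.TaoAveragedRotations
import Mathlib.Analysis.InnerProductSpace.Calculus
import HarnessLib

/-!
# Tao 2016, §3.8–§3.9 on `Γ`: the smooth unit normal `n(η)`, the non-degeneracy (3.24) on `Γ`,
and the representation (3.21) with a weight `F''(θ, η)` smooth in `(θ, η)`

T. Tao, *Finite time blowup for an averaged three-dimensional Navier–Stokes equation*,
J. Amer. Math. Soc. **29** (2016), 601–674 = arXiv:1402.0290v3 (held as `paper:arxiv-1402.0290`;
equation and page numbers are those of that text), §3.7 (3.18):
`Γ := {(η₁,η₂,η₃) ∈ Πⱼ B(ξⱼ⁰, Cε₀³) : η₁ + η₂ + η₃ = 0}`; §3.8, p. 19: "if `(η₁,η₂,η₃) ∈ Γ`, then the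
vectors `η₁,η₂,η₃` are coplanar, and so we may find a unit vector `n = n(η₁,η₂,η₃)` orthogonal to
all of the `ηᵢ`; by the implicit function theorem we may ensure that `n` depends smoothly on
`η₁,η₂,η₃`. From (3.7) we may normalise `n` to be close to `(0,0,1)`"; §3.9 (3.24).

Completing `TaoAveragedNondegeneracy.lean` and `TaoAveragedAngleSynthesis.lean` (which treat the
base vectors `η` and the normal `n` as parameters), this file makes the choices on `Γ`:

* `gammaNormal η = (η₁ × η₂)/|η₁ × η₂|` — **the unit normal `n(η)`**, explicitly (no implicit
  function theorem is needed): orthogonal to `η₁, η₂`, and to `η₃` when `η₁ + η₂ + η₃ = 0`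
  (`inner_gammaNormal`), equal to `(0,0,1)` at `ξ⁰` (`gammaNormal_xi0`, as `ξ₁⁰ × ξ₂⁰ = (0,0,1)`),
  smooth where `η₁ × η₂ ≠ 0` (`contDiffAt_gammaNormal`), and within distance `1` of `(0,0,1)`
  near `ξ⁰` (`gammaNormal_near_xi0`);
* `contDiffAt_cSigma`, `contDiffAt_rotCoeff`, `contDiffAt_tensorWeight` — smoothness of `c_σ`,
  of the coefficient vectors and of **the tensor weight `F''(θ, η)` jointly in `(θ, η)`** along any
  smooth normal field, away from `ηⱼ = 0` and from `c_σ = 0`;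
* `nondegeneracy_on_Gamma` — **(3.24) on `Γ` near (3.7)**: a `δ > 0` such that for
  `|ηⱼ - ξⱼ⁰| ≤ δ`, `η₁ + η₂ + η₃ = 0`: all `ηⱼ ≠ 0`, `n(η)` is a unit normal of the `ηⱼ`, and
  `c_σ(η, n(η)) ≠ 0` for all `σ`;
* `tensorRepresentation_on_Gamma` — **the representation (3.21) on `Γ` near (3.7) with the explicit
  weight `F''(θ, η) = tensorWeight η n(η) θ`, smooth in `(θ, η)`**: the function `F''` that §3.7
  asks for ("Thus it suffices to find a smooth function `F''` with the representation (3.21)");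
* `realΛ_isometry` — the real `Λ` is invariant under a common rotation of frequencies and vectors
  (the real form of `Λ_rotMat` of `TaoAveragedRotations.lean`, the bookkeeping identity of the
  ansatz (3.19)–(3.20), §3.7).

Smoothness of `udir` and of the cross product are those of `TaoAveragedRotations.lean`
(`contDiffAt_udir`, `contDiff_cross`).

## References

* T. Tao, J. Amer. Math. Soc. 29 (2016), 601–674, arXiv:1402.0290v3, §3.7 (3.18)–(3.21) p. 19;
  §3.8 pp. 19–20; §3.9 (3.24) p. 20. Key `Tao2016AveragedNS`.
-/

noncomputable section

open Real Matrix MeasureTheory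
open scoped RealInnerProductSpace

namespace Literature.Analysis.FluidPDE.Tao2016

/-- Local notation for physical / frequency space `ℝ³`. -/
local notation "ℝ³" => EuclideanSpace ℝ (Fin 3)

/-! ### The canonical unit normal `n(η) = (η₁ × η₂)/|η₁ × η₂|` on `Γ` -/

/-- **The unit normal `n = n(η₁,η₂,η₃)` of §3.8** ("we may find a unit vector `n` orthogonal to all
of the `ηᵢ`; by the implicit function theorem we may ensure that `n` depends smoothly on
`η₁,η₂,η₃` … we may normalise `n` to be close to `(0,0,1)`"), realised explicitly as
`n(η) = (η₁ × η₂)/|η₁ × η₂|` (indices `0, 1` in Lean): on `Γ` (where `η₁ + η₂ + η₃ = 0`) it is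
orthogonal to all three `ηⱼ`, and at `ξ⁰` it equals `(0,0,1)`. Junk value `0` when `η₁ ∥ η₂`
(`udir 0 = 0`), which is why the orthogonality lemmas below need no hypothesis. [cite: Tao2016AveragedNS, §3.8 p. 19] -/
def gammaNormal (η : Fin 3 → ℝ³) : ℝ³ := udir (cross (η 0) (η 1))

/-- `ξ₁⁰ × ξ₂⁰ = (0,0,1)`. [cite: Tao2016AveragedNS, (3.7)] -/
theorem cross_xi0_zero_one : cross (xi0 0) (xi0 1) = northVec := by
  ext i
  fin_cases i <;> simp [cross_apply_zero, cross_apply_one, cross_apply_two, xi0, northVec]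

/-- `n(ξ⁰) = (0,0,1)`. [cite: Tao2016AveragedNS, §3.8 p. 19] -/
theorem gammaNormal_xi0 : gammaNormal xi0 = northVec := by
  rw [gammaNormal, cross_xi0_zero_one, udir, norm_northVec, inv_one, one_smul]

section NormalProperties

variable {η : Fin 3 → ℝ³}

/-- `|n(η)| = 1` when `η₁ × η₂ ≠ 0`. [cite: Tao2016AveragedNS, §3.8 p. 19] -/
theorem norm_gammaNormal (h : cross (η 0) (η 1) ≠ 0) : ‖gammaNormal η‖ = 1 :=
  norm_udir h

/-- `n(η) ⊥ η₁`. [cite: Tao2016AveragedNS, §3.8 p. 19] -/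
theorem inner_gammaNormal_zero (η : Fin 3 → ℝ³) : ⟪gammaNormal η, η 0⟫ = 0 := by
  rw [gammaNormal, udir, real_inner_smul_left, inner_cross_self_left, mul_zero]

/-- `n(η) ⊥ η₂`. [cite: Tao2016AveragedNS, §3.8 p. 19] -/
theorem inner_gammaNormal_one (η : Fin 3 → ℝ³) : ⟪gammaNormal η, η 1⟫ = 0 := by
  rw [gammaNormal, udir, real_inner_smul_left, inner_cross_self_right, mul_zero]

/-- `n(η) ⊥ η₃` on `Γ` (`η₁ + η₂ + η₃ = 0`: "the vectors `η₁,η₂,η₃` are coplanar"). [cite: Tao2016AveragedNS, §3.8 p. 19] -/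
theorem inner_gammaNormal_two (hsum : η 0 + η 1 + η 2 = 0) : ⟪gammaNormal η, η 2⟫ = 0 := by
  have h2 : η 2 = -(η 0 + η 1) := eq_neg_of_add_eq_zero_right hsum
  rw [h2, inner_neg_right, inner_add_right, inner_gammaNormal_zero, inner_gammaNormal_one, add_zero, neg_zero]

/-- `n(η) ⊥ ηⱼ` for all `j`, on `Γ`. [cite: Tao2016AveragedNS, §3.8 p. 19] -/
theorem inner_gammaNormal (hsum : η 0 + η 1 + η 2 = 0) (j : Fin 3) : ⟪gammaNormal η, η j⟫ = 0 := by
  match j with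
  | 0 => exact inner_gammaNormal_zero η
  | 1 => exact inner_gammaNormal_one η
  | 2 => exact inner_gammaNormal_two hsum

end NormalProperties

/-! ### Smoothness away from the degenerate configurations -/

section Smoothness

variable {E : Type*} [NormedAddCommGroup E] [NormedSpace ℝ E] {n : WithTop ℕ∞}

/-- The cross product of two smooth fields is smooth (pointwise form of `contDiff_cross`). [folklore] -/
theorem contDiffAt_cross {f g : E → ℝ³} {x : E} (hf : ContDiffAt ℝ n f x) (hg : ContDiffAt ℝ n g x) :
    ContDiffAt ℝ n (fun y => cross (f y) (g y)) x :=
  contDiff_cross.contDiffAt.comp x (hf.prodMk hg)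

/-- A coordinate of a smooth `ℝ³`-valued field is smooth. [folklore] -/
theorem contDiffAt_coord {f : E → ℝ³} {x : E} (hf : ContDiffAt ℝ n f x) (a : Fin 3) :
    ContDiffAt ℝ n (fun y => f y a) x :=
  ((EuclideanSpace.proj a : ℝ³ →L[ℝ] ℝ).contDiff.of_le le_top).comp_contDiffAt x hf

/-- A real-valued smooth function is smooth as a complex-valued one. [folklore] -/
theorem contDiffAt_ofReal_comp {f : E → ℝ} {x : E} (hf : ContDiffAt ℝ n f x) :
    ContDiffAt ℝ n (fun y => (f y : ℂ)) x :=
  (Complex.ofRealCLM.contDiff.of_le le_top).comp_contDiffAt x hf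

/-- Composition with a coordinate of the parameter `η`. [folklore] -/
theorem contDiffAt_comp_apply {F : Type*} [NormedAddCommGroup F] [NormedSpace ℝ F] {g : ℝ³ → F}
    {η : Fin 3 → ℝ³} (j : Fin 3) (hg : ContDiffAt ℝ n g (η j)) :
    ContDiffAt ℝ n (fun η' : Fin 3 → ℝ³ => g (η' j)) η :=
  ContDiffAt.comp η (g := g) (f := fun η' : Fin 3 → ℝ³ => η' j) hg (contDiffAt_apply ℝ ℝ³ j η)

/-- Composition with the second component of the parameter `(θ, η)`. [folklore] -/
theorem contDiffAt_comp_snd_param {F : Type*} [NormedAddCommGroup F] [NormedSpace ℝ F]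
    {g : (Fin 3 → ℝ³) → F} {θ : Fin 3 → ℝ} {η : Fin 3 → ℝ³} (hg : ContDiffAt ℝ n g η) :
    ContDiffAt ℝ n (fun p : (Fin 3 → ℝ) × (Fin 3 → ℝ³) => g p.2) (θ, η) :=
  ContDiffAt.comp (θ, η) (g := g) (f := fun p : (Fin 3 → ℝ) × (Fin 3 → ℝ³) => p.2) hg contDiffAt_snd

/-- The coordinates `θⱼ` of the parameter `(θ, η)` are smooth (as complex numbers). [folklore] -/
theorem contDiffAt_theta_coord (θ : Fin 3 → ℝ) (η : Fin 3 → ℝ³) (j : Fin 3) :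
    ContDiffAt ℝ n (fun p : (Fin 3 → ℝ) × (Fin 3 → ℝ³) => ((p.1 j : ℝ) : ℂ)) (θ, η) :=
  contDiffAt_ofReal_comp
    (ContDiffAt.comp (θ, η) (g := fun θ' : Fin 3 → ℝ => θ' j)
      (f := fun p : (Fin 3 → ℝ) × (Fin 3 → ℝ³) => p.1) (contDiffAt_apply ℝ ℝ j θ) contDiffAt_fst)

/-- `η ↦ n(η)` is smooth where `η₁ × η₂ ≠ 0`. [cite: Tao2016AveragedNS, §3.8 p. 19] -/
theorem contDiffAt_gammaNormal {η : Fin 3 → ℝ³} (h : cross (η 0) (η 1) ≠ 0) :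
    ContDiffAt ℝ n gammaNormal η := by
  have h0 : ContDiffAt ℝ n (fun η : Fin 3 → ℝ³ => η 0) η := contDiffAt_apply ℝ ℝ³ 0 η
  have h1 : ContDiffAt ℝ n (fun η : Fin 3 → ℝ³ => η 1) η := contDiffAt_apply ℝ ℝ³ 1 η
  exact ContDiffAt.comp η (g := udir) (f := fun η' : Fin 3 → ℝ³ => cross (η' 0) (η' 1))
    (contDiffAt_udir h) (contDiffAt_cross h0 h1)

/-- **`c_σ(η, N(η))` is smooth in `η`** wherever all `ηⱼ ≠ 0` and the normal field `N` is smooth. [folklore] -/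
theorem contDiffAt_cSigma {N : (Fin 3 → ℝ³) → ℝ³} {η : Fin 3 → ℝ³} (hη : ∀ j, η j ≠ 0)
    (hN : ContDiffAt ℝ n N η) (σ : Fin 3 → ℤˣ) :
    ContDiffAt ℝ n (fun η' => cSigma η' (N η') σ) η := by
  have hev : ∀ j, ContDiffAt ℝ n (fun η' : Fin 3 → ℝ³ => η' j) η := fun j => contDiffAt_apply ℝ ℝ³ j η
  have hu : ∀ j, ContDiffAt ℝ n (fun η' : Fin 3 → ℝ³ => udir (η' j)) η := fun j =>
    contDiffAt_comp_apply j (contDiffAt_udir (hη j))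
  have hA : ∀ j k, ContDiffAt ℝ n (fun η' : Fin 3 → ℝ³ =>
      ((⟪cross (udir (η' j)) (N η'), η' k⟫ : ℝ) : ℂ)) η := fun j k =>
    contDiffAt_ofReal_comp ((contDiffAt_cross (hu j) hN).inner ℝ (hev k))
  have hP : ∀ j k, ContDiffAt ℝ n (fun η' : Fin 3 → ℝ³ =>
      ((⟪udir (η' j), udir (η' k)⟫ : ℝ) : ℂ)) η := fun j k =>
    contDiffAt_ofReal_comp ((hu j).inner ℝ (hu k))
  have hT1 : ContDiffAt ℝ n (fun η' : Fin 3 → ℝ³ =>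
      ((⟪cross (udir (η' 0)) (N η'), η' 1⟫ : ℝ) : ℂ) * ((σ 0 : ℤ) : ℂ) *
        (1 - ((⟪udir (η' 1), udir (η' 2)⟫ : ℝ) : ℂ) * ((σ 1 : ℤ) : ℂ) * ((σ 2 : ℤ) : ℂ))) η :=
    ((hA 0 1).mul contDiffAt_const).mul
      (contDiffAt_const.sub (((hP 1 2).mul contDiffAt_const).mul contDiffAt_const))
  have hT2 : ContDiffAt ℝ n (fun η' : Fin 3 → ℝ³ =>
      ((⟪cross (udir (η' 1)) (N η'), η' 0⟫ : ℝ) : ℂ) * ((σ 1 : ℤ) : ℂ) *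
        (1 - ((⟪udir (η' 0), udir (η' 2)⟫ : ℝ) : ℂ) * ((σ 0 : ℤ) : ℂ) * ((σ 2 : ℤ) : ℂ))) η :=
    ((hA 1 0).mul contDiffAt_const).mul
      (contDiffAt_const.sub (((hP 0 2).mul contDiffAt_const).mul contDiffAt_const))
  unfold cSigma
  exact contDiffAt_const.mul (hT1.add hT2)

/-- The coefficient vectors `V_{ηⱼ}^s(N(η))_a` are smooth in `η`. [folklore] -/
theorem contDiffAt_rotCoeff {N : (Fin 3 → ℝ³) → ℝ³} {η : Fin 3 → ℝ³} (hη : ∀ j, η j ≠ 0)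
    (hN : ContDiffAt ℝ n N η) (j : Fin 3) (s : ℤˣ) (a : Fin 3) :
    ContDiffAt ℝ n (fun η' => rotCoeff (η' j) (N η') s a) η := by
  have hu : ContDiffAt ℝ n (fun η' : Fin 3 → ℝ³ => udir (η' j)) η :=
    contDiffAt_comp_apply j (contDiffAt_udir (hη j))
  have h1 : ContDiffAt ℝ n (fun η' : Fin 3 → ℝ³ => ((N η' a : ℝ) : ℂ)) η :=
    contDiffAt_ofReal_comp (contDiffAt_coord hN a)
  have h2 : ContDiffAt ℝ n (fun η' : Fin 3 → ℝ³ => ((cross (udir (η' j)) (N η') a : ℝ) : ℂ)) η :=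
    contDiffAt_ofReal_comp (contDiffAt_coord (contDiffAt_cross hu hN) a)
  unfold rotCoeff
  exact (h1.div_const 2).sub (((contDiffAt_const.mul contDiffAt_const).mul h2).div_const 2)

/-- **The tensor weight `F''(θ, η) = tensorWeight η N(η) θ` is jointly smooth in `(θ, η)`**
wherever all `ηⱼ ≠ 0`, the normal field `N` is smooth and the non-degeneracy `c_σ(η, N(η)) ≠ 0`
holds (Tao: "a smooth function `F''`"). [cite: Tao2016AveragedNS, §3.8 (3.21) p. 19] -/
theorem contDiffAt_tensorWeight {N : (Fin 3 → ℝ³) → ℝ³} {θ : Fin 3 → ℝ} {η : Fin 3 → ℝ³}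
    (hη : ∀ j, η j ≠ 0) (hN : ContDiffAt ℝ n N η) (hc : ∀ σ, cSigma η (N η) σ ≠ 0) (a b c : Fin 3) :
    ContDiffAt ℝ n (fun p : (Fin 3 → ℝ) × (Fin 3 → ℝ³) => tensorWeight p.2 (N p.2) p.1 a b c) (θ, η) := by
  have hθ : ∀ j, ContDiffAt ℝ n (fun p : (Fin 3 → ℝ) × (Fin 3 → ℝ³) => ((p.1 j : ℝ) : ℂ)) (θ, η) :=
    fun j => contDiffAt_theta_coord θ η j
  -- the angular exponential
  have hexp : ∀ σ : Fin 3 → ℤˣ, ContDiffAt ℝ n (fun p : (Fin 3 → ℝ) × (Fin 3 → ℝ³) =>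
      Complex.exp (-(Complex.I * ∑ j, ((σ j : ℤ) : ℂ) * ((p.1 j : ℝ) : ℂ)))) (θ, η) := by
    intro σ
    refine (Complex.contDiff_exp.of_le le_top).comp_contDiffAt (θ, η) ?_
    exact (contDiffAt_const.mul (ContDiffAt.sum fun j _ => contDiffAt_const.mul (hθ j))).neg
  -- the coefficients
  have hcS : ∀ σ : Fin 3 → ℤˣ, ContDiffAt ℝ n (fun p : (Fin 3 → ℝ) × (Fin 3 → ℝ³) =>
      cSigma p.2 (N p.2) σ) (θ, η) := fun σ => contDiffAt_comp_snd_param (contDiffAt_cSigma hη hN σ)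
  have hW : ∀ σ : Fin 3 → ℤˣ, ContDiffAt ℝ n (fun p : (Fin 3 → ℝ) × (Fin 3 → ℝ³) =>
      angleWeight p.2 (N p.2) σ p.1) (θ, η) := by
    intro σ
    unfold angleWeight
    exact (((hcS σ).inv (hc σ)).div_const _).mul (hexp σ)
  have hR : ∀ (j : Fin 3) (s : ℤˣ) (d : Fin 3), ContDiffAt ℝ n (fun p : (Fin 3 → ℝ) × (Fin 3 → ℝ³) =>
      rotCoeff (p.2 j) (N p.2) s d) (θ, η) := fun j s d =>
    contDiffAt_comp_snd_param (contDiffAt_rotCoeff hη hN j s d)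
  unfold tensorWeight
  exact ContDiffAt.sum fun σ _ => (hW σ).mul (((hR 0 (σ 0) a).mul (hR 1 (σ 1) b)).mul (hR 2 (σ 2) c))

end Smoothness

/-! ### Non-degeneracy and the representation (3.21) on `Γ` near the configuration (3.7) -/

/-- Near `ξ⁰` the normal `n(η)` is defined (`η₁ × η₂ ≠ 0`) and on the side of `(0,0,1)`
(`|n(η) - (0,0,1)| ≤ 1`), by continuity at `ξ⁰`. [cite: Tao2016AveragedNS, §3.8 p. 19] -/
theorem gammaNormal_near_xi0 : ∃ δ : ℝ, 0 < δ ∧ ∀ η : Fin 3 → ℝ³, (∀ j, ‖η j - xi0 j‖ ≤ δ) →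
    cross (η 0) (η 1) ≠ 0 ∧ ‖gammaNormal η - northVec‖ ≤ 1 := by
  -- continuity of `η ↦ η₁ × η₂` and of `n` at `ξ⁰`
  have hc1 : ContinuousAt (fun η : Fin 3 → ℝ³ => cross (η 0) (η 1)) xi0 :=
    (contDiffAt_cross (n := 0) (contDiffAt_apply ℝ ℝ³ 0 xi0) (contDiffAt_apply ℝ ℝ³ 1 xi0)).continuousAt
  have hne : cross (xi0 0) (xi0 1) ≠ 0 := by
    rw [cross_xi0_zero_one]
    intro h
    have := norm_northVec
    rw [h, norm_zero] at this
    exact zero_ne_one this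
  have hc2 : ContinuousAt gammaNormal xi0 := (contDiffAt_gammaNormal (n := 0) hne).continuousAt
  rw [Metric.continuousAt_iff] at hc1 hc2
  obtain ⟨δ₁, hδ₁, h₁⟩ := hc1 (1 / 2) (by norm_num)
  obtain ⟨δ₂, hδ₂, h₂⟩ := hc2 1 one_pos
  refine ⟨min δ₁ δ₂ / 2, by positivity, fun η hη => ?_⟩
  have hdist : dist η xi0 < min δ₁ δ₂ := by
    rw [dist_eq_norm]
    have : ‖η - xi0‖ ≤ min δ₁ δ₂ / 2 :=
      (pi_norm_le_iff_of_nonneg (by positivity)).mpr fun j => by simpa using hη j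
    linarith [lt_min hδ₁ hδ₂]
  constructor
  · intro h0
    have h := h₁ (hdist.trans_le (min_le_left _ _))
    rw [h0, cross_xi0_zero_one, dist_eq_norm, zero_sub, norm_neg, norm_northVec] at h
    norm_num at h
  · have h := h₂ (hdist.trans_le (min_le_right _ _))
    rw [gammaNormal_xi0, dist_eq_norm] at h
    exact h.le

/-- **Non-degeneracy (3.24) on `Γ` near (3.7)** with the canonical normal: there is `δ > 0` such
that for all `η` with `|ηⱼ - ξⱼ⁰| ≤ δ` and `η₁ + η₂ + η₃ = 0`, all `ηⱼ ≠ 0`, `η₁ × η₂ ≠ 0`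
(so that `n` is smooth at `η`, `contDiffAt_gammaNormal`), `n(η)` is a unit normal of the `ηⱼ`, and
`c_σ(η, n(η)) ≠ 0` for all `σ ∈ {−1,+1}³` — Tao's "the
non-degeneracy claim (3.24) follows for `ε₀` small enough" (`Γ ⊆ Πⱼ B(ξⱼ⁰, Cε₀³)`). [cite: Tao2016AveragedNS, §3.9 (3.24) p. 20] -/
theorem nondegeneracy_on_Gamma : ∃ δ : ℝ, 0 < δ ∧ ∀ η : Fin 3 → ℝ³, (∀ j, ‖η j - xi0 j‖ ≤ δ) →
    η 0 + η 1 + η 2 = 0 →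
      (∀ j, η j ≠ 0) ∧ cross (η 0) (η 1) ≠ 0 ∧ ‖gammaNormal η‖ = 1 ∧
        (∀ j, ⟪gammaNormal η, η j⟫ = 0) ∧ ∀ σ, cSigma η (gammaNormal η) σ ≠ 0 := by
  obtain ⟨δ₁, hδ₁, h₁⟩ := gammaNormal_near_xi0
  obtain ⟨δ₂, hδ₂, h₂⟩ := cSigma_ne_zero_near_xi0
  refine ⟨min (min δ₁ δ₂) (1 / 2), by positivity, fun η hη hsum => ?_⟩
  have hη₁ : ∀ j, ‖η j - xi0 j‖ ≤ δ₁ := fun j => (hη j).trans ((min_le_left _ _).trans (min_le_left _ _))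
  have hη₂ : ∀ j, ‖η j - xi0 j‖ ≤ δ₂ := fun j => (hη j).trans ((min_le_left _ _).trans (min_le_right _ _))
  obtain ⟨hcr, hN⟩ := h₁ η hη₁
  have hn1 : ‖gammaNormal η‖ = 1 := norm_gammaNormal hcr
  have hn : ∀ j, ⟪gammaNormal η, η j⟫ = 0 := inner_gammaNormal hsum
  have hne : ∀ j, η j ≠ 0 := by
    intro j h0
    have h := (hη j).trans (min_le_right _ _)
    rw [h0, zero_sub, norm_neg] at h
    have h1 : (1 : ℝ) ≤ ‖xi0 j‖ := by
      match j with
      | 0 => rw [norm_xi0_zero]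
      | 1 => rw [norm_xi0_one]; exact Real.one_le_sqrt.mpr (by norm_num)
      | 2 => rw [norm_xi0_two]
    linarith
  exact ⟨hne, hcr, hn1, hn, h₂ η (gammaNormal η) hη₂ hn1 hn hN⟩

/-- **The representation (3.21) ("bigmess-4") on `Γ` near (3.7), with an explicit smooth weight.**
There is `δ > 0` such that for every `η = (η₁,η₂,η₃)` with `|ηⱼ - ξⱼ⁰| ≤ δ` and
`η₁ + η₂ + η₃ = 0` (i.e. `η ∈ Γ`), every `Yⱼ ∈ ηⱼ^⊥` and all components `a, b, c`:
`(Y₁)_a (Y₂)_b (Y₃)_c = ∫_{(0,2π]³} F''_{abc}(θ, η) Λ_η(R_{η₁}^{θ₁}Y₁, R_{η₂}^{θ₂}Y₂, R_{η₃}^{θ₃}Y₃) dθ`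
with `F''(θ, η) = tensorWeight η n(η) θ`, which is smooth in `(θ, η)` on that set
(`contDiffAt_tensorWeight` with `contDiffAt_gammaNormal` and `nondegeneracy_on_Gamma`) and a
trigonometric polynomial in `θ` (so `2π`-periodic: a function on `(ℝ/2πℤ)³ × Γ`; the periodicity is
not restated). This is
the function `F''` that §3.7 asks for ("Thus it suffices to find a smooth function `F''` with the
representation (3.21)"). [cite: Tao2016AveragedNS, §3.8 (3.21) p. 19] -/
theorem tensorRepresentation_on_Gamma : ∃ δ : ℝ, 0 < δ ∧ ∀ η : Fin 3 → ℝ³, (∀ j, ‖η j - xi0 j‖ ≤ δ) →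
    η 0 + η 1 + η 2 = 0 →
      (∀ (θ : Fin 3 → ℝ) (a b c : Fin 3), ContDiffAt ℝ ((⊤ : ℕ∞) : WithTop ℕ∞)
          (fun p : (Fin 3 → ℝ) × (Fin 3 → ℝ³) => tensorWeight p.2 (gammaNormal p.2) p.1 a b c) (θ, η)) ∧
        ∀ (Y : Fin 3 → ℝ³), (∀ j, ⟪Y j, η j⟫ = 0) → ∀ a b c : Fin 3,
          ((Y 0 a : ℝ) : ℂ) * ((Y 1 b : ℝ) : ℂ) * ((Y 2 c : ℝ) : ℂ) =
            ∫ θ in Set.pi Set.univ (fun _ : Fin 3 => Set.Ioc (0 : ℝ) (2 * π)),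
              tensorWeight η (gammaNormal η) θ a b c *
                (realΛ (η 0) (η 1) (rodRot (η 0) (θ 0) (Y 0)) (rodRot (η 1) (θ 1) (Y 1))
                  (rodRot (η 2) (θ 2) (Y 2)) : ℂ) := by
  obtain ⟨δ, hδ, h⟩ := nondegeneracy_on_Gamma
  refine ⟨δ, hδ, fun η hη hsum => ?_⟩
  obtain ⟨hne, hcr, hn1, hn, hc⟩ := h η hη hsum
  refine ⟨fun θ a b c => contDiffAt_tensorWeight hne (contDiffAt_gammaNormal hcr) hc a b c, ?_⟩
  intro Y hY a b c
  exact tensor_eq_integral_realΛ_rodRot hne hn1 hn hc Y hY a b c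

/-! ### §3.7 bookkeeping: the real `Λ` is invariant under a common rotation -/

/-- **`Λ_{Sξ₁,Sξ₂,Sξ₃}(SX₁, SX₂, SX₃) = Λ_{ξ₁,ξ₂,ξ₃}(X₁, X₂, X₃)` for a linear isometry `S`** (real
vectors): the identity behind the display after (3.20) ("from (1.4) we see that
`Λ_{R₁ξ₁,R₂ξ₂,R₃ξ₃}(R₁X₁,R₂X₂,R₃X₃) = Λ_{ξ̃₁,ξ̃₂,ξ̃₃}(R^{θ₁}_{ξ̃₁}R_{1,ξ}X₁, …)`" for the ansatz
`Rⱼ = S R^{θⱼ}_{ξ̃ⱼ} R_{j,ξ}`, together with `R^θ_{ξ̃ⱼ} ξ̃ⱼ = ξ̃ⱼ`, `rodRot_axis`). [cite: Tao2016AveragedNS, §3.7 p. 19] -/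
theorem realΛ_isometry (S : ℝ³ →ₗᵢ[ℝ] ℝ³) (ξ₁ ξ₂ X₁ X₂ X₃ : ℝ³) :
    realΛ (S ξ₁) (S ξ₂) (S X₁) (S X₂) (S X₃) = realΛ ξ₁ ξ₂ X₁ X₂ X₃ := by
  simp only [realΛ, LinearIsometry.inner_map_map]

end Literature.Analysis.FluidPDE.Tao2016
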